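import Mathlib
import HarnessLib
import Summits.PneNP.PneNP.Theorems.CnfIdealGenLengthRankDefectRepresentationsGoodBlocks
import Summits.PneNP.PneNP.Theorems.CnfIdealGenLengthRankDefectRepresentationsSequentialInsertion
import Summits.PneNP.PneNP.Theorems.CnfIdealGenLengthRankDefectRepresentationsIntertwiner
import Summits.PneNP.PneNP.Theorems.CnfIdealGenLengthRankDefectRepresentationsRankMatching
import Summits.PneNP.PneNP.Theorems.CnfIdealGenLengthRankDefectRepresentationsCellAssembly

/-!
# Absolute merge with a constant depending on the cross data `c` ONLY (crux `RankDefectRepresentations` =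
# stmt-PneNP-18923, line `cell-union-merge`; lead g18)

`absoluteMerge_cellIndependent`: for every `c` there is `L = L(c)` such that, over any field of characteristic zero and for
complete orthogonal systems `P : X → K^{d×d}`, `Q : Y → K^{d×d}` of ANY sizes with `rank [P_A, Q_B] ≤ c` for all unions,
there is a COMMUTING pair of complete orthogonal systems `(P', Q')` with `rank (P_A − P'_A) ≤ L`, `rank (Q_B − Q'_B) ≤ L` for
all unions.  The registered lead stub `stub_absoluteMerge` asks for `L = λ·c` with `λ` absolute; here `L(c) = 2^{O(c)}` —
absoluteness in `|X|, |Y|, d` is a THEOREM, linearity in `c` is what stays open (memo `Lines/cell-union-merge-g18.md` §8–§9).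

Proof (memo §9): family cut lemma (`…FamilyCutLemma`, frame `r ≤ 32c`) → good blocks (`…GoodBlocks`, exceptional set `S`,
`|S| ≤ 10r`) → coarsen `P` to `S ⊔ {∗}` and merge by sequential insertion (`…SequentialInsertion.absoluteMerge_card`, cost
depends on `|S| + 1 ≤ 320c + 1` only) → rank-match the `∗`-cell inside the commutant (`…RankMatching`) → intertwine it with
`P_∗ = Σ_{x∉S} P_x` (`…Intertwiner`) → transport the good cells and the exact family `(G_y P_∗)_y` along the intertwiner.
HONEST FRAMING: negative lane; AMB (linear in c), CoreBE, N0b and the crux stay open; P ≠ NP is not moved; F-N2 is a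
FRONTIER formal rung.
-/

set_option linter.dupNamespace false -- `Summit.PneNP.PneNP.…`: summit = sub-problem name (D-0017)

namespace Summit.PneNP.PneNP.Theorems.CnfIdealGenLengthRankDefectRepresentationsCellIndependent

open Matrix Module
open Summit.PneNP.PneNP.Theorems.CnfIdealGenLengthRankDefectRepresentationsFamilyCutLemma (familyCutLemma rank_mul_le_inner)
open Summit.PneNP.PneNP.Theorems.CnfIdealGenLengthRankDefectRepresentationsGoodBlocks
  (goodBlocks card_filter_mul_ne_zero_le_rank)
open Summit.PneNP.PneNP.Theorems.CnfIdealGenLengthRankDefectRepresentationsSequentialInsertion (absoluteMerge_card)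
open Summit.PneNP.PneNP.Theorems.CnfIdealGenLengthRankDefectRepresentationsIntertwiner (exists_intertwiner)
open Summit.PneNP.PneNP.Theorems.CnfIdealGenLengthRankDefectRepresentationsRankMatching
  (exists_nested_commuting_idempotent_rank_eq)
open Summit.PneNP.PneNP.Theorems.CnfIdealGenLengthRankDefectRepresentationsPolyOfAbsoluteMergeLevels
  (cells_sum_mul_sum prod_cells_idem prod_cells_orth prod_cells_sum rank_sub_triangle rank_comm_perturb)
open Summit.PneNP.PneNP.Theorems.CnfIdealGenLengthRankDefectRepresentationsMergeLowerBound (rank_add_le' rank_sub_le' rank_neg')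
open Summit.PneNP.PneNP.Theorems.CnfIdealGenLengthRankDefectRepresentationsCutLemmaMaxCut (rank_finsetSum_le)

variable {K : Type} [Field K] {d : ℕ}

/-! ## Tools -/

section Tools

/-- `|rank A − rank B| ≤ rank (A − B)` (truncated form). [folklore] -/
theorem rank_dist_le (A B : Matrix (Fin d) (Fin d) K) : (A.rank - B.rank) + (B.rank - A.rank) ≤ (A - B).rank := by
  have h1 : A.rank ≤ B.rank + (A - B).rank := by
    have := rank_add_le' B (A - B); rwa [add_sub_cancel] at this
  have h2 : B.rank ≤ A.rank + (A - B).rank := by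
    have := rank_sub_le' A (A - B); rwa [sub_sub_cancel] at this
  omega

/-- Conjugation is rank-preserving up to `2 · rank (T − 1)`: `rank (T M T' − M) ≤ 2 rank (T − 1)` when `T T' = 1`. [folklore] -/
theorem rank_conj_sub_le (T T' M : Matrix (Fin d) (Fin d) K) (hTT' : T * T' = 1) :
    (T * M * T' - M).rank ≤ (T - 1).rank + (T - 1).rank := by
  have hT'1 : T' - 1 = -(T' * (T - 1)) := by
    rw [Matrix.mul_sub, Matrix.mul_one]
    have : T' * T = 1 := mul_eq_one_comm.mp hTT'
    rw [this]; abel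
  have e : T * M * T' - M = (T - 1) * M * T' + M * (T' - 1) := by
    simp only [Matrix.sub_mul, Matrix.mul_sub, Matrix.one_mul, Matrix.mul_one]; abel
  rw [e]
  refine (rank_add_le' _ _).trans (Nat.add_le_add ?_ ?_)
  · exact (Matrix.rank_mul_le_left _ _).trans (Matrix.rank_mul_le_left _ _)
  · rw [hT'1, Matrix.mul_neg, rank_neg']
    exact (Matrix.rank_mul_le_right _ _).trans (Matrix.rank_mul_le_right _ _)

end Tools

/-! ## The theorem -/

section Main

variable [CharZero K] {X Y : Type} [Fintype X] [Fintype Y] [DecidableEq X] [DecidableEq Y]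

/-- **Absolute merge with a cell-independent constant.**  For every `c` there is `L` (depending on `c` only) such that any two
complete orthogonal systems of idempotents over a field of characteristic zero whose unions have cross commutators of rank `≤ c`
are union-wise within rank `L` of a commuting pair. -/
theorem absoluteMerge_cellIndependent (c : ℕ) : ∃ L : ℕ, ∀ (K : Type) [Field K] [CharZero K] (d : ℕ) (X Y : Type)
    [Fintype X] [Fintype Y] [DecidableEq X] [DecidableEq Y]
    (P : X → Matrix (Fin d) (Fin d) K) (Q : Y → Matrix (Fin d) (Fin d) K),
    (∀ x, P x * P x = P x) → (∀ x x', x ≠ x' → P x * P x' = 0) → ∑ x, P x = 1 →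
    (∀ y, Q y * Q y = Q y) → (∀ y y', y ≠ y' → Q y * Q y' = 0) → ∑ y, Q y = 1 →
    (∀ (A : Finset X) (B : Finset Y),
      ((∑ x ∈ A, P x) * (∑ y ∈ B, Q y) - (∑ y ∈ B, Q y) * (∑ x ∈ A, P x)).rank ≤ c) →
    ∃ (P' : X → Matrix (Fin d) (Fin d) K) (Q' : Y → Matrix (Fin d) (Fin d) K),
      (∀ x, P' x * P' x = P' x) ∧ (∀ x x', x ≠ x' → P' x * P' x' = 0) ∧ ∑ x, P' x = 1 ∧
      (∀ y, Q' y * Q' y = Q' y) ∧ (∀ y y', y ≠ y' → Q' y * Q' y' = 0) ∧ ∑ y, Q' y = 1 ∧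
      (∀ x y, P' x * Q' y = Q' y * P' x) ∧
      (∀ A : Finset X, ((∑ x ∈ A, P x) - ∑ x ∈ A, P' x).rank ≤ L) ∧
      (∀ B : Finset Y, ((∑ y ∈ B, Q y) - ∑ y ∈ B, Q' y).rank ≤ L) := by
  refine ⟨(320 * c + 1) * (100 * (32 * (320 * c + 1) ^ 3 * 4616 ^ (320 * c + 1) * c) + 64 * c), ?_⟩
  intro K _ _ d X Y _ _ _ _ P Q hPi hPo hPs hQi hQo hQs hc
  classical
  set m₀ : ℕ := 320 * c + 1 with hm₀
  set s₁ : ℕ := 32 * m₀ ^ 3 * 4616 ^ m₀ * c with hs₁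
  -- Step 1: family cut lemma and the exceptional set
  obtain ⟨r, U, W, hr, key⟩ := familyCutLemma P Q c hPi hPo hPs hQi hQo hQs hc
  choose G α β hGP hQ using key
  obtain ⟨S₁, hS₁, hgood⟩ := goodBlocks P Q G r U W α β hPi hPo hQi hQo (fun x y => hGP y x) hQ
  have hM : ∀ x, (1 - ∑ y, G y) * P x = P x * (1 - ∑ y, G y) := by
    intro x
    rw [Matrix.sub_mul, Matrix.mul_sub, Matrix.one_mul, Matrix.mul_one, Finset.sum_mul, Finset.mul_sum]
    congr 1
    exact Finset.sum_congr rfl fun y _ => hGP y x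
  obtain ⟨T₀, hT₀card, hT₀⟩ := card_filter_mul_ne_zero_le_rank P (1 - ∑ y, G y) hPi hPo hM
  have hNB : ∀ B : Finset Y, ((∑ y ∈ B, Q y) - ∑ y ∈ B, G y).rank ≤ 2 * r := by
    intro B
    have h1 : (∑ y ∈ B, Q y) - ∑ y ∈ B, G y = U * (∑ y ∈ B, α y) + (∑ y ∈ B, β y) * W := by
      rw [Matrix.mul_sum, Matrix.sum_mul, ← Finset.sum_add_distrib, ← Finset.sum_sub_distrib]
      exact Finset.sum_congr rfl fun y _ => by rw [hQ y]; abel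
    rw [h1]
    refine (rank_add_le' _ _).trans ?_
    have := rank_mul_le_inner U (∑ y ∈ B, α y); have := rank_mul_le_inner (∑ y ∈ B, β y) W; omega
  have hrank1G : ((1 : Matrix (Fin d) (Fin d) K) - ∑ y, G y).rank ≤ 2 * r := by
    have := hNB Finset.univ; rwa [hQs] at this
  let S : Finset X := S₁ ∪ T₀
  have hScard : S.card ≤ 10 * r :=
    (Finset.card_union_le _ _).trans (by have := hT₀card.trans hrank1G; omega)
  have hgoodS : ∀ x ∉ S, (∀ y y', P x * G y * (P x * G y') = if y = y' then P x * G y else 0) ∧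
      P x * (∑ y, G y) = P x := by
    intro x hx
    have hx₁ : x ∉ S₁ := fun h => hx (Finset.mem_union_left _ h)
    have hxT : x ∉ T₀ := fun h => hx (Finset.mem_union_right _ h)
    refine ⟨fun y y' => ?_, ?_⟩
    · by_cases h : y = y'
      · subst h; rw [if_pos rfl]; exact (hgood x hx₁).1 y
      · rw [if_neg h]; exact (hgood x hx₁).2 y y' h
    · have h0 := hT₀ x hxT
      rw [Matrix.mul_sub, Matrix.mul_one, sub_eq_zero] at h0
      exact h0.symm
  have hGcomm : ∀ x y, P x * G y = G y * P x := fun x y => (hGP y x).symm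
  have hprod : ∀ x y y', P x * G y * (P x * G y') = P x * (G y * G y') := by
    intro x y y'
    calc P x * G y * (P x * G y') = P x * ((G y * P x) * G y') := by simp only [Matrix.mul_assoc]
      _ = P x * ((P x * G y) * G y') := by rw [hGcomm]
      _ = (P x * P x) * (G y * G y') := by simp only [Matrix.mul_assoc]
      _ = P x * (G y * G y') := by rw [hPi]
  by_cases hSe : S = ∅
  · have hall : ∀ x, (∀ y y', P x * G y * (P x * G y') = if y = y' then P x * G y else 0) ∧ P x * (∑ y, G y) = P x :=
      fun x => hgoodS x (by rw [hSe]; exact Finset.notMem_empty x)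
    have hGy : ∀ y y', G y * G y' = if y = y' then G y else 0 := by
      intro y y'
      calc G y * G y' = (∑ x, P x) * (G y * G y') := by rw [hPs, Matrix.one_mul]
        _ = ∑ x, P x * G y * (P x * G y') := by
            rw [Finset.sum_mul]
            exact Finset.sum_congr rfl fun x _ => (hprod x y y').symm
        _ = ∑ x, (if y = y' then P x * G y else 0) := Finset.sum_congr rfl fun x _ => (hall x).1 y y'
        _ = if y = y' then G y else 0 := by
            split_ifs with h
            · rw [← Finset.sum_mul, hPs, Matrix.one_mul]
            · simp
    have hGs : ∑ y, G y = 1 := by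
      calc ∑ y, G y = (∑ x, P x) * ∑ y, G y := by rw [hPs, Matrix.one_mul]
        _ = ∑ x, P x := by rw [Finset.sum_mul]; exact Finset.sum_congr rfl fun x _ => (hall x).2
        _ = 1 := hPs
    refine ⟨P, G, hPi, hPo, hPs, fun y => by simpa using hGy y y, fun y y' h => by simpa [h] using hGy y y', hGs,
      hGcomm, fun A => ?_, fun B => (hNB B).trans ?_⟩
    · rw [sub_self, Matrix.rank_zero]; exact Nat.zero_le _
    · have : 2 * r ≤ 64 * c := by omega
      nlinarith
  obtain ⟨x₁, hx₁⟩ := Finset.nonempty_of_ne_empty hSe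
  -- Step 2: the coarse system on `Option S`
  let Pstar : Matrix (Fin d) (Fin d) K := ∑ x ∈ Sᶜ, P x
  have hPu := cells_sum_mul_sum P hPi hPo
  have hPstar_idem : Pstar * Pstar = Pstar := by show (∑ x ∈ Sᶜ, P x) * _ = _; rw [hPu, Finset.inter_self]
  have hPstar_x : ∀ x ∈ S, Pstar * P x = 0 ∧ P x * Pstar = 0 := by
    intro x hx
    have h1 : (∑ x' ∈ Sᶜ, P x') * (∑ x' ∈ ({x} : Finset X), P x') = 0 := by
      rw [hPu, Finset.inter_singleton_of_notMem (by simpa using hx), Finset.sum_empty]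
    have h2 : (∑ x' ∈ ({x} : Finset X), P x') * (∑ x' ∈ Sᶜ, P x') = 0 := by
      rw [hPu, Finset.singleton_inter_of_notMem (by simpa using hx), Finset.sum_empty]
    rw [Finset.sum_singleton] at h1 h2
    exact ⟨h1, h2⟩
  have hPstar_good : ∀ x ∉ S, Pstar * P x = P x ∧ P x * Pstar = P x := by
    intro x hx
    have hxc : x ∈ Sᶜ := Finset.mem_compl.mpr hx
    have h1 : (∑ x' ∈ Sᶜ, P x') * (∑ x' ∈ ({x} : Finset X), P x') = P x := by
      rw [hPu, Finset.inter_singleton_of_mem hxc, Finset.sum_singleton]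
    have h2 : (∑ x' ∈ ({x} : Finset X), P x') * (∑ x' ∈ Sᶜ, P x') = P x := by
      rw [hPu, Finset.singleton_inter_of_mem hxc, Finset.sum_singleton]
    rw [Finset.sum_singleton] at h1 h2
    exact ⟨h1, h2⟩
  have hPS_sum : Pstar + ∑ x ∈ S, P x = 1 := by
    show (∑ x ∈ Sᶜ, P x) + ∑ x ∈ S, P x = 1
    rw [← Finset.sum_union (disjoint_compl_left)]
    have : Sᶜ ∪ S = (Finset.univ : Finset X) := by ext x; simp [or_comm, em]
    rw [this, hPs]
  let Pc : Option S → Matrix (Fin d) (Fin d) K := fun o => o.elim Pstar fun x => P x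
  have hPci : ∀ o, Pc o * Pc o = Pc o := by
    rintro (_ | ⟨x, hx⟩)
    · exact hPstar_idem
    · exact hPi x
  have hPco : ∀ o o', o ≠ o' → Pc o * Pc o' = 0 := by
    rintro (_ | ⟨x, hx⟩) (_ | ⟨x', hx'⟩) h
    · exact absurd rfl h
    · exact (hPstar_x x' hx').1
    · exact (hPstar_x x hx).2
    · exact hPo x x' fun e => h (by subst e; rfl)
  have hPcs : ∑ o, Pc o = 1 := by
    rw [Fintype.sum_option]
    show Pstar + ∑ x : S, P x = 1
    rw [Finset.sum_coe_sort S (fun x => P x)]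
    exact hPS_sum
  have hPcc : ∀ o (B : Finset Y), (Pc o * (∑ y ∈ B, Q y) - (∑ y ∈ B, Q y) * Pc o).rank ≤ c := by
    rintro (_ | ⟨x, hx⟩) B
    · exact hc Sᶜ B
    · have := hc {x} B; rwa [Finset.sum_singleton] at this
  -- Step 3: sequential insertion on the coarse system
  obtain ⟨Pc', hPc'i, hPc'o, hPc's, hPc'Q, hPc'r⟩ := absoluteMerge_card Pc Q c hPci hPco hPcs hQi hQo hQs hPcc
  have hcardO : Fintype.card (Option S) ≤ m₀ := by
    rw [Fintype.card_option, Fintype.card_coe]; omega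
  have hs₁bound : 32 * Fintype.card (Option S) ^ 3 * 4616 ^ Fintype.card (Option S) * c ≤ s₁ := by
    rw [hs₁]
    have h1 : Fintype.card (Option S) ^ 3 ≤ m₀ ^ 3 := Nat.pow_le_pow_left hcardO 3
    have h2 : 4616 ^ Fintype.card (Option S) ≤ 4616 ^ m₀ := Nat.pow_le_pow_right (by norm_num) hcardO
    exact Nat.mul_le_mul (Nat.mul_le_mul (Nat.mul_le_mul_left 32 h1) h2) le_rfl
  have hclose : ∀ A : Finset (Option S), ((∑ o ∈ A, Pc o) - ∑ o ∈ A, Pc' o).rank ≤ s₁ :=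
    fun A => (hPc'r A).trans hs₁bound
  set E' := Pc' none with hE'def
  have hE'i : E' * E' = E' := hPc'i none
  have hE'Q : ∀ y, E' * Q y = Q y * E' := fun y => hPc'Q none y
  have hE'some : ∀ o : S, E' * Pc' (some o) = 0 ∧ Pc' (some o) * E' = 0 :=
    fun o => ⟨hPc'o none (some o) (by simp), hPc'o (some o) none (by simp)⟩
  have hE'close : (Pstar - E').rank ≤ s₁ := by
    have := hclose {none}; rwa [Finset.sum_singleton, Finset.sum_singleton] at this
  -- Step 4: rank matching inside the commutant of the product system `Pc' × Q`
  let Rsys : Option S × Y → Matrix (Fin d) (Fin d) K := fun p => Pc' p.1 * Q p.2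
  have hRcomm : ∀ o y, Pc' o * Q y = Q y * Pc' o := hPc'Q
  have hRi : ∀ p, Rsys p * Rsys p = Rsys p := fun p => prod_cells_idem Pc' Q hPc'i hQi hRcomm p
  have hRo : ∀ p q, p ≠ q → Rsys p * Rsys q = 0 := fun p q h => prod_cells_orth Pc' Q hPc'o hQo hRcomm p q h
  have hRs : ∑ p, Rsys p = 1 := prod_cells_sum Pc' Q hPc's hQs
  have hE'R : ∀ p, E' * Rsys p = Rsys p * E' := by
    rintro ⟨o, y⟩
    show E' * (Pc' o * Q y) = Pc' o * Q y * E'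
    rcases o with _ | o
    · show E' * (E' * Q y) = E' * Q y * E'
      rw [← Matrix.mul_assoc, hE'i, Matrix.mul_assoc, ← hE'Q y, ← Matrix.mul_assoc, hE'i]
    · rw [← Matrix.mul_assoc, (hE'some o).1, Matrix.zero_mul, Matrix.mul_assoc, ← hE'Q y, ← Matrix.mul_assoc,
        (hE'some o).2, Matrix.zero_mul]
  obtain ⟨E'', hE''i, hE''R, hE''rank, hE''close, hE'E'', hnest⟩ :=
    exists_nested_commuting_idempotent_rank_eq Rsys E' Pstar.rank hRi hRo hRs hE'i hE'R (Matrix.rank_le_width Pstar)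
  have hE''Q : ∀ y, E'' * Q y = Q y * E'' := by
    intro y
    have : Q y = ∑ p ∈ (Finset.univ : Finset (Option S)) ×ˢ ({y} : Finset Y), Rsys p := by
      rw [Finset.sum_product]
      simp only [Finset.sum_singleton]
      show Q y = ∑ o, Pc' o * Q y
      rw [← Finset.sum_mul, hPc's, Matrix.one_mul]
    rw [this, Finset.mul_sum, Finset.sum_mul]
    exact Finset.sum_congr rfl fun p _ => hE''R p
  have hE''Pc' : ∀ o, E'' * Pc' o = Pc' o * E'' := by
    intro o
    have : Pc' o = ∑ p ∈ ({o} : Finset (Option S)) ×ˢ (Finset.univ : Finset Y), Rsys p := by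
      rw [Finset.sum_product, Finset.sum_singleton]
      show Pc' o = ∑ y, Pc' o * Q y
      rw [← Finset.mul_sum, hQs, Matrix.mul_one]
    rw [this, Finset.mul_sum, Finset.sum_mul]
    exact Finset.sum_congr rfl fun p _ => hE''R p
  have hE'E''close : (E' - E'').rank ≤ s₁ := by
    refine hE''close.trans ?_
    have h := rank_dist_le E' Pstar
    rw [← neg_sub, rank_neg'] at h
    omega
  -- Step 5: the intertwiner `Tm P_* Ti = E''`
  obtain ⟨Tm, Ti, hTT, hTT', hTint, hTrank⟩ := exists_intertwiner Pstar E'' hPstar_idem hE''i hE''rank.symm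
  have hTs₁ : (Tm - 1).rank ≤ 4 * s₁ := by
    refine hTrank.trans ?_
    have := rank_sub_triangle Pstar E' E''
    omega
  have hTconj : Tm * Pstar * Ti = E'' := by rw [hTint, Matrix.mul_assoc, hTT, Matrix.mul_one]
  -- Step 6: the new systems (their exactness and commutation: `…CellAssembly.assembly`)
  obtain ⟨hP'i, hP'o, hP's, hQ'i, hQ's, hcommPQ⟩ :=
    Summit.PneNP.PneNP.Theorems.CnfIdealGenLengthRankDefectRepresentationsCellAssembly.assembly P Q G S x₁ hx₁
      (fun o => Pc' (some o)) E' E'' Tm Ti hPi hPo hQi hQo hQs hGcomm hgoodS (fun o => hPc'i (some o))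
      (fun o o' h => hPc'o (some o) (some o') (fun e => h (Option.some_injective _ e))) hE'some hE'i
      (by rw [← hPc's, Fintype.sum_option, add_comm]) (fun o y => hPc'Q (some o) y) hE'Q hE''i hE''Q
      (fun o => hE''Pc' (some o)) hE'E'' hTT hTT' hTint
  set Lft : Matrix (Fin d) (Fin d) K := E' * (1 - E'') with hLft
  set P' : X → Matrix (Fin d) (Fin d) K := fun x =>
    if hx : x ∈ S then Pc' (some ⟨x, hx⟩) * (1 - E'') + (if x = x₁ then Lft else 0) else Tm * P x * Ti with hP'
  set Q' : Y → Matrix (Fin d) (Fin d) K := fun y => Q y * (1 - E'') + Tm * (G y * Pstar) * Ti with hQ'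
  -- restate the assembly facts for `P'`, `Q'` (definitional unfolding)
  have hP'i' : ∀ x, P' x * P' x = P' x := hP'i
  have hP'o' : ∀ x x', x ≠ x' → P' x * P' x' = 0 := hP'o
  have hP's' : ∑ x, P' x = 1 := hP's
  have hQ'i' : ∀ y y', Q' y * Q' y' = if y = y' then Q' y else 0 := hQ'i
  have hQ's' : ∑ y, Q' y = 1 := hQ's
  have hcommPQ' : ∀ x y, P' x * Q' y = Q' y * P' x := hcommPQ
  have hP'S : ∀ x (hx : x ∈ S), P' x = Pc' (some ⟨x, hx⟩) * (1 - E'') + (if x = x₁ then Lft else 0) :=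
    fun x hx => dif_pos hx
  have hP'G : ∀ x, x ∉ S → P' x = Tm * P x * Ti := fun x hx => dif_neg hx
  -- bounds
  have hE''E'sub : (E'' - E').rank ≤ s₁ := by rw [← neg_sub, rank_neg']; exact hE'E''close
  have hLrank : Lft.rank ≤ s₁ := by
    have : Lft = E' * (E' - E'') := by
      show E' * (1 - E'') = E' * (E' - E''); rw [Matrix.mul_sub, Matrix.mul_sub, Matrix.mul_one, hE'i]
    rw [this]; exact (Matrix.rank_mul_le_right _ _).trans hE'E''close
  refine ⟨P', Q', hP'i', hP'o', hP's', fun y => by have h := hQ'i' y y; rwa [if_pos rfl] at h,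
    fun y y' hne => by have h := hQ'i' y y'; rwa [if_neg hne] at h, hQ's', hcommPQ', fun A => ?_, fun B => ?_⟩
  · -- `P`-unions: the part outside `S` is conjugated as a whole; the ≤ |S| cells inside `S` are paid one by one
    rw [← Finset.sum_filter_add_sum_filter_not A (fun x => x ∈ S) P,
      ← Finset.sum_filter_add_sum_filter_not A (fun x => x ∈ S) P']
    have e : (∑ x ∈ A.filter (fun x => x ∈ S), P x + ∑ x ∈ A.filter (fun x => ¬ x ∈ S), P x) -
        (∑ x ∈ A.filter (fun x => x ∈ S), P' x + ∑ x ∈ A.filter (fun x => ¬ x ∈ S), P' x) =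
        (∑ x ∈ A.filter (fun x => x ∈ S), (P x - P' x)) +
        ((∑ x ∈ A.filter (fun x => ¬ x ∈ S), P x) - ∑ x ∈ A.filter (fun x => ¬ x ∈ S), P' x) := by
      rw [Finset.sum_sub_distrib]; abel
    rw [e]
    refine (rank_add_le' _ _).trans ?_
    -- inside `S`: each cell moves by ≤ 3 s₁
    have hcell : ∀ x ∈ S, (P x - P' x).rank ≤ 3 * s₁ := by
      intro x hx
      rw [hP'S x hx]
      have h0 : (P x - Pc' (some ⟨x, hx⟩)).rank ≤ s₁ := by
        have := hclose {some ⟨x, hx⟩}; rwa [Finset.sum_singleton, Finset.sum_singleton] at this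
      have h1 : (Pc' (some ⟨x, hx⟩) * E'').rank ≤ s₁ := by
        have : Pc' (some ⟨x, hx⟩) * E'' = Pc' (some ⟨x, hx⟩) * (E'' - E') := by
          rw [Matrix.mul_sub, (hE'some ⟨x, hx⟩).2, sub_zero]
        rw [this]; exact (Matrix.rank_mul_le_right _ _).trans hE''E'sub
      have e1 : P x - (Pc' (some ⟨x, hx⟩) * (1 - E'') + if x = x₁ then Lft else 0) =
          (P x - Pc' (some ⟨x, hx⟩)) + Pc' (some ⟨x, hx⟩) * E'' - (if x = x₁ then Lft else 0) := by
        rw [Matrix.mul_sub, Matrix.mul_one]; abel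
      rw [e1]
      refine (rank_sub_le' _ _).trans ((Nat.add_le_add_right (rank_add_le' _ _) _).trans ?_)
      have h2 : (if x = x₁ then Lft else (0 : Matrix (Fin d) (Fin d) K)).rank ≤ s₁ := by
        split_ifs
        · exact hLrank
        · rw [Matrix.rank_zero]; exact Nat.zero_le _
      omega
    have hin : (∑ x ∈ A.filter (fun x => x ∈ S), (P x - P' x)).rank ≤ S.card * (3 * s₁) := by
      refine (rank_finsetSum_le _ _).trans ?_
      calc ∑ x ∈ A.filter (fun x => x ∈ S), (P x - P' x).rank
          ≤ ∑ x ∈ A.filter (fun x => x ∈ S), 3 * s₁ :=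
            Finset.sum_le_sum fun x hx => hcell x (Finset.mem_filter.mp hx).2
        _ = (A.filter (fun x => x ∈ S)).card * (3 * s₁) := by rw [Finset.sum_const, smul_eq_mul]
        _ ≤ S.card * (3 * s₁) := Nat.mul_le_mul_right _ (Finset.card_le_card fun x hx => (Finset.mem_filter.mp hx).2)
    -- outside `S`: one conjugation
    have hout : ((∑ x ∈ A.filter (fun x => ¬ x ∈ S), P x) - ∑ x ∈ A.filter (fun x => ¬ x ∈ S), P' x).rank ≤ 8 * s₁ := by
      have e2 : ∑ x ∈ A.filter (fun x => ¬ x ∈ S), P' x = Tm * (∑ x ∈ A.filter (fun x => ¬ x ∈ S), P x) * Ti := by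
        rw [Finset.mul_sum, Finset.sum_mul]
        exact Finset.sum_congr rfl fun x hx => hP'G x (Finset.mem_filter.mp hx).2
      rw [e2, ← neg_sub, rank_neg']
      refine (rank_conj_sub_le Tm Ti _ hTT).trans ?_
      omega
    have hSm : S.card ≤ m₀ := by omega
    have hm1 : 1 ≤ m₀ := by omega
    have h1 : S.card * (3 * s₁) ≤ m₀ * (3 * s₁) := Nat.mul_le_mul_right _ hSm
    have h2 : 8 * s₁ ≤ m₀ * (97 * s₁) :=
      calc 8 * s₁ ≤ 97 * s₁ := Nat.mul_le_mul_right _ (by norm_num)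
        _ = 1 * (97 * s₁) := (one_mul _).symm
        _ ≤ m₀ * (97 * s₁) := Nat.mul_le_mul_right _ hm1
    have : S.card * (3 * s₁) + 8 * s₁ ≤ m₀ * (100 * s₁ + 64 * c) :=
      calc S.card * (3 * s₁) + 8 * s₁ ≤ m₀ * (3 * s₁) + m₀ * (97 * s₁) := Nat.add_le_add h1 h2
        _ = m₀ * (100 * s₁) := by ring
        _ ≤ m₀ * (100 * s₁ + 64 * c) := Nat.mul_le_mul_left _ (Nat.le_add_right _ _)
    exact (Nat.add_le_add hin hout).trans this
  · -- `Q`-unions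
    have eQ1 : ∑ y ∈ B, Q' y = (∑ y ∈ B, Q y) * (1 - E'') + Tm * ((∑ y ∈ B, G y) * Pstar) * Ti := by
      show ∑ y ∈ B, (Q y * (1 - E'') + Tm * (G y * Pstar) * Ti) = _
      have h1 : ∑ y ∈ B, Q y * (1 - E'') = (∑ y ∈ B, Q y) * (1 - E'') := by rw [Finset.sum_mul]
      have h2 : ∑ y ∈ B, Tm * (G y * Pstar) * Ti = Tm * ((∑ y ∈ B, G y) * Pstar) * Ti := by
        rw [Finset.sum_mul (s := B) (f := fun y => G y), Finset.mul_sum, Finset.sum_mul]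
      rw [Finset.sum_add_distrib, h1, h2]
    have eQ : (∑ y ∈ B, Q y) - ∑ y ∈ B, Q' y = (∑ y ∈ B, Q y) * E'' - Tm * ((∑ y ∈ B, G y) * Pstar) * Ti := by
      rw [eQ1, Matrix.mul_sub, Matrix.mul_one]; abel
    rw [eQ]
    have e3 : (∑ y ∈ B, Q y) * E'' - Tm * ((∑ y ∈ B, G y) * Pstar) * Ti =
        (∑ y ∈ B, Q y) * (E'' - Pstar) + ((∑ y ∈ B, Q y) - ∑ y ∈ B, G y) * Pstar -
        (Tm * ((∑ y ∈ B, G y) * Pstar) * Ti - (∑ y ∈ B, G y) * Pstar) := by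
      rw [Matrix.mul_sub, Matrix.sub_mul]; abel
    rw [e3]
    refine (rank_sub_le' _ _).trans ((Nat.add_le_add_right (rank_add_le' _ _) _).trans ?_)
    have h1 : ((∑ y ∈ B, Q y) * (E'' - Pstar)).rank ≤ 2 * s₁ := by
      refine (Matrix.rank_mul_le_right _ _).trans ?_
      have := rank_sub_triangle E'' E' Pstar
      have h' : (E' - Pstar).rank ≤ s₁ := by rw [← neg_sub, rank_neg']; exact hE'close
      omega
    have h2 : (((∑ y ∈ B, Q y) - ∑ y ∈ B, G y) * Pstar).rank ≤ 2 * r := (Matrix.rank_mul_le_left _ _).trans (hNB B)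
    have h3 : (Tm * ((∑ y ∈ B, G y) * Pstar) * Ti - (∑ y ∈ B, G y) * Pstar).rank ≤ 8 * s₁ :=
      (rank_conj_sub_le Tm Ti _ hTT).trans (by omega)
    have hm1 : 1 ≤ m₀ := by omega
    have hr64 : 2 * r ≤ 64 * c := by omega
    have : 2 * s₁ + 2 * r + 8 * s₁ ≤ m₀ * (100 * s₁ + 64 * c) :=
      calc 2 * s₁ + 2 * r + 8 * s₁ ≤ 100 * s₁ + 64 * c := by omega
        _ = 1 * (100 * s₁ + 64 * c) := (one_mul _).symm
        _ ≤ m₀ * (100 * s₁ + 64 * c) := Nat.mul_le_mul_right _ hm1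
    omega

end Main

end Summit.PneNP.PneNP.Theorems.CnfIdealGenLengthRankDefectRepresentationsCellIndependent
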